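import Summits.AtomisticToContinuum.Crystallization.Theorems.GappedShellCensusCleanLimitsHaveWindowsCleanChartTSteps1
import Summits.AtomisticToContinuum.Crystallization.Theorems.GappedShellCensusCleanLimitsHaveWindowsCleanChartTSteps6
import Summits.AtomisticToContinuum.Crystallization.Theorems.GappedShellCensusCleanLimitsHaveWindowsCleanChartTSteps7
import Summits.AtomisticToContinuum.Crystallization.Theorems.GappedShellCensusCleanLimitsHaveWindowsCleanChartTLower
import Summits.AtomisticToContinuum.Crystallization.Theorems.PalmUnimodularRigidityShellsToBarlowChartTransportVinv

/-!
# `CleanLimitsHaveWindows` (stmt-AtomisticToContinuum-15932), line `Sketch` — stub K1 (`stub_cleanChart`):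
# the transport development re-run on CLEAN charts — copy of `PalmUnimodularRigidityShellsToBarlowChartTransportVinv`

This file is a mechanical copy of `Theorems/PalmUnimodularRigidityShellsToBarlowChartTransportVinv.lean` (crux `ShellsToBarlowChart`,
route `PalmUnimodularRigidity`; original title: Line `develop-the-model-growth-descent` (crux `ShellsToBarlowChart`, stmt-AtomisticToContinuum-9227): the downward transport `V⁻¹` (specification))
in which the chart hypothesis `hch : ∀ z ∈ S, IsZChart S z (ac z) (Pc z) (Ac z) (nb z)` (integer charts with
`1 %` closeness) is replaced by the CLEAN-CHART hypothesis: at every site a labelling of the bonded neighbours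
by `fcc3Int`/`hcpInt`, bijective, with bonds among neighbours = label pairs at squared distance `18`, together
with the TRANSFER property across every bond (proved for clean sets at matching radius `1/5` in
`…CleanChartTransfer`).  The original development uses its metric hypothesis only through the transfer
lemma, so all proofs go through verbatim; declarations live in the sub-namespace `….Clean` and shadow the
originals, the `hch`-free lemmas of the original file are reused, not restated.  All `[folklore]`.
-/

noncomputable section

namespace Summit.AtomisticToContinuum.Crystallization.Theorems.PalmUnimodularRigidityShellsToBarlowChart.Clean

open Literature.Geometry.DiscreteGeometry Literature.MathematicalPhysics.StatisticalMechanics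
open Summit.AtomisticToContinuum.Crystallization.Theorems.ShellsToBarlowChartNegative

variable {S : Set (EuclideanSpace ℝ (Fin 3))} {Pc : (EuclideanSpace ℝ (Fin 3)) → Finset (Fin 3 → ℤ)}
  {nb : (EuclideanSpace ℝ (Fin 3)) → (Fin 3 → ℤ) → (EuclideanSpace ℝ (Fin 3))}

/-- **Polarity at the lower apex** (mirror of `polar_at_apex`): a site attached to `x` through a
lower-cap label of a valid frame at `x`, if HCP, sees `x` as a polar label. [folklore] -/
theorem polar_at_lower_apex (hch : ((∀ z ∈ S, (Pc z = fcc3Int ∨ Pc z = hcpInt) ∧ Set.BijOn (nb z) (↑(Pc z) : Set (Fin 3 → ℤ)) {y | y ∈ S ∧ (0 < dist z y ∧ dist z y ≤ 28 / 25)} ∧ (∀ t ∈ Pc z, ∀ t' ∈ Pc z, ((0 < dist (nb z t) (nb z t') ∧ dist (nb z t) (nb z t') ≤ 28 / 25) ↔ sqNormInt (t - t') = 18))) ∧ (∀ x ∈ S, ∀ y ∈ S, (0 < dist x y ∧ dist x y ≤ 28 / 25) → ∀ t ∈ Pc x, ∀ t' ∈ Pc x, ∀ u ∈ Pc y, ∀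 u' ∈ Pc y, nb y u = nb x t → nb y u' = nb x t' → sqNormInt (u - u') = sqNormInt (t - t')))) {x : (EuclideanSpace ℝ (Fin 3))}
    (hx : x ∈ S) {t₁ t₂ : Fin 3 → ℤ} {U : Finset (Fin 3 → ℤ)} (hU : IsFrame (Pc x) t₁ t₂ U)
    {c : Fin 3 → ℤ} (hcL : c ∈ lowerCap (Pc x) t₁ t₂ U) (hhcp : Pc (nb x c) = hcpInt) :
    -zlab Pc nb (nb x c) x ∉ Pc (nb x c) := by
  intro hneg
  have hcP : c ∈ Pc x := (mem_lowerCap_iff.1 hcL).1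
  have hu := nb_mem hch hx hcP
  have hξ := zlab_spec hch hu.1 hx (bond_symm hu.2)
  have hξP : zlab Pc nb (nb x c) x ∈ hcpInt := by rw [← hhcp]; exact hξ.1
  rw [hhcp] at hneg
  obtain ⟨m, hm, n, hn, hξm, hξn, hmn⟩ := exists_mirror_pair_of_equatorial _ hξP hneg
  have hmP : m ∈ Pc (nb x c) := by rw [hhcp]; exact hm
  have hnP : n ∈ Pc (nb x c) := by rw [hhcp]; exact hn
  have hzm := nb_mem hch hu.1 hmP
  have hzn := nb_mem hch hu.1 hnP
  have hbm : 0 < dist (nb (nb x c) m) x ∧ dist (nb (nb x c) m) x ≤ 28 / 25 := by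
    have := (bond_nb_iff hch hu.1 hmP hξ.1).2 (by rw [sqNormInt_sub_comm]; exact hξm)
    rwa [hξ.2] at this
  have hbn : 0 < dist (nb (nb x c) n) x ∧ dist (nb (nb x c) n) x ≤ 28 / 25 := by
    have := (bond_nb_iff hch hu.1 hnP hξ.1).2 (by rw [sqNormInt_sub_comm]; exact hξn)
    rwa [hξ.2] at this
  have ha := zlab_spec hch hx hzm.1 (bond_symm hbm)
  have hb := zlab_spec hch hx hzn.1 (bond_symm hbn)
  have hac : sqNormInt (zlab Pc nb x (nb (nb x c) m) - c) = 18 :=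
    (bond_nb_iff hch hx ha.1 hcP).1 (by rw [ha.2]; exact bond_symm hzm.2)
  have hbc : sqNormInt (zlab Pc nb x (nb (nb x c) n) - c) = 18 :=
    (bond_nb_iff hch hx hb.1 hcP).1 (by rw [hb.2]; exact bond_symm hzn.2)
  have htr := transfer_nb_nb hch hx hu.1 hu.2 ha.1 hb.1 (by rw [ha.2]; exact hzm.2)
    (by rw [hb.2]; exact hzn.2)
  rw [ha.2, hb.2, zlab_nb hch hu.1 hmP, zlab_nb hch hu.1 hnP, hmn] at htr
  exact no_48_around_polar (Pc x) (pattern_cases hch hx) c hcP _ ha.1 _ hb.1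
    (cap_label_polar_or_fcc_lower (pattern_cases hch hx) hU hcL)
    (by rw [sqNormInt_sub_comm]; exact hac) (by rw [sqNormInt_sub_comm]; exact hbc) htr.symm

/-- **One-sidedness at a common lower apex** (mirror of `onesided_at_apex`). [folklore] -/
theorem onesided_at_lower_apex (hch : ((∀ z ∈ S, (Pc z = fcc3Int ∨ Pc z = hcpInt) ∧ Set.BijOn (nb z) (↑(Pc z) : Set (Fin 3 → ℤ)) {y | y ∈ S ∧ (0 < dist z y ∧ dist z y ≤ 28 / 25)} ∧ (∀ t ∈ Pc z, ∀ t' ∈ Pc z, ((0 < dist (nb z t) (nb z t') ∧ dist (nb z t) (nb z t') ≤ 28 / 25) ↔ sqNormInt (t - t') = 18))) ∧ (∀ x ∈ S, ∀ y ∈ S, (0 < dist x y ∧ dist x y ≤ 28 / 25) → ∀ t ∈ Pc x, ∀ t' ∈ Pc x, ∀ u ∈ Pc y, ∀ u' ∈ Pc y, nb y u = nb x t → nb y u' = nb x t' → sqNormInt (u - u') = sqNormInt (t - t'))))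
    {x x' : (EuclideanSpace ℝ (Fin 3))} (hx : x ∈ S) (hx' : x' ∈ S) {t₁ t₂ t₁' t₂' : Fin 3 → ℤ}
    {U U' : Finset (Fin 3 → ℤ)} (hU : IsFrame (Pc x) t₁ t₂ U) (hU' : IsFrame (Pc x') t₁' t₂' U')
    {c c' : Fin 3 → ℤ} (hcL : c ∈ lowerCap (Pc x) t₁ t₂ U)
    (hcL' : c' ∈ lowerCap (Pc x') t₁' t₂' U') (heq : nb x c = nb x' c') :
    (-zlab Pc nb (nb x c) x ∈ Pc (nb x c) ∧ -zlab Pc nb (nb x c) x' ∈ Pc (nb x c)) ∨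
      (-zlab Pc nb (nb x c) x ∉ Pc (nb x c) ∧ -zlab Pc nb (nb x c) x' ∉ Pc (nb x c)) := by
  have hcP : c ∈ Pc x := (mem_lowerCap_iff.1 hcL).1
  have hcP' : c' ∈ Pc x' := (mem_lowerCap_iff.1 hcL').1
  have hu := nb_mem hch hx hcP
  have hu' := nb_mem hch hx' hcP'
  have hξ := zlab_spec hch hu.1 hx (bond_symm hu.2)
  have hξ' := zlab_spec hch hu.1 hx' (by rw [heq]; exact bond_symm hu'.2)
  rcases pattern_cases hch hu.1 with hF | hH
  · left
    rw [hF] at hξ hξ' ⊢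
    exact ⟨neg_mem_fcc3Int _ hξ.1, neg_mem_fcc3Int _ hξ'.1⟩
  · right
    refine ⟨polar_at_lower_apex hch hx hU hcL hH, ?_⟩
    have := polar_at_lower_apex hch hx' hU' hcL' (by rw [← heq]; exact hH)
    rwa [← heq] at this

/-- **The V⁻¹-step** (mirror of `Vstep_spec`).  For a valid frame `g = ⟨x, t₁, t₂, U⟩` whose four
in-layer transports are valid frames, `VinvStep g` lands at the lower apex site `d = nb x c'`
(`c'` the apex of the lower cap `L`), is a valid frame of parity `lowerParity t₁ t₂ L` (the
letter below `x`), and its upper cap consists of the labels at `d` of `x` and of the two in-layer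
neighbours of `x` above `d` (`nb x (∓t₁), nb x (∓t₂)`, sign = that letter). [folklore] -/
theorem VinvStep_spec (hch : ((∀ z ∈ S, (Pc z = fcc3Int ∨ Pc z = hcpInt) ∧ Set.BijOn (nb z) (↑(Pc z) : Set (Fin 3 → ℤ)) {y | y ∈ S ∧ (0 < dist z y ∧ dist z y ≤ 28 / 25)} ∧ (∀ t ∈ Pc z, ∀ t' ∈ Pc z, ((0 < dist (nb z t) (nb z t') ∧ dist (nb z t) (nb z t') ≤ 28 / 25) ↔ sqNormInt (t - t') = 18))) ∧ (∀ x ∈ S, ∀ y ∈ S, (0 < dist x y ∧ dist x y ≤ 28 / 25) → ∀ t ∈ Pc x, ∀ t' ∈ Pc x, ∀ u ∈ Pc y, ∀ u' ∈ Pc y, nb y u = nb x t → nb y u' = nb x t' → sqNormInt (u - u') = sqNormInt (t - t')))) {x : (EuclideanSpace ℝ (Fin 3))}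
    (hx : x ∈ S) {t₁ t₂ : Fin 3 → ℤ} {U : Finset (Fin 3 → ℤ)} (hU : IsFrame (Pc x) t₁ t₂ U)
    (hI : IsFrame (Pc (nb x t₁)) (Istep Pc nb ⟨x, t₁, t₂, U⟩).t₁ (Istep Pc nb ⟨x, t₁, t₂, U⟩).t₂
      (Istep Pc nb ⟨x, t₁, t₂, U⟩).U)
    (hJ : IsFrame (Pc (nb x t₂)) (Jstep Pc nb ⟨x, t₁, t₂, U⟩).t₁ (Jstep Pc nb ⟨x, t₁, t₂, U⟩).t₂
      (Jstep Pc nb ⟨x, t₁, t₂, U⟩).U)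
    (hIi : IsFrame (Pc (nb x (-t₁))) (IinvStep Pc nb ⟨x, t₁, t₂, U⟩).t₁
      (IinvStep Pc nb ⟨x, t₁, t₂, U⟩).t₂ (IinvStep Pc nb ⟨x, t₁, t₂, U⟩).U)
    (hJi : IsFrame (Pc (nb x (-t₂))) (JinvStep Pc nb ⟨x, t₁, t₂, U⟩).t₁
      (JinvStep Pc nb ⟨x, t₁, t₂, U⟩).t₂ (JinvStep Pc nb ⟨x, t₁, t₂, U⟩).U) :
    apexOf t₁ t₂ (lowerCap (Pc x) t₁ t₂ U) ∈ lowerCap (Pc x) t₁ t₂ U ∧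
    nb x (apexOf t₁ t₂ (lowerCap (Pc x) t₁ t₂ U)) ∈ S ∧
    (0 < dist x (nb x (apexOf t₁ t₂ (lowerCap (Pc x) t₁ t₂ U))) ∧
      dist x (nb x (apexOf t₁ t₂ (lowerCap (Pc x) t₁ t₂ U))) ≤ 28 / 25) ∧
    zlab Pc nb (nb x (apexOf t₁ t₂ (lowerCap (Pc x) t₁ t₂ U))) x ∈
      Pc (nb x (apexOf t₁ t₂ (lowerCap (Pc x) t₁ t₂ U))) ∧
    nb (nb x (apexOf t₁ t₂ (lowerCap (Pc x) t₁ t₂ U)))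
      (zlab Pc nb (nb x (apexOf t₁ t₂ (lowerCap (Pc x) t₁ t₂ U))) x) = x ∧
    IsFrame (Pc (nb x (apexOf t₁ t₂ (lowerCap (Pc x) t₁ t₂ U)))) (VinvStep Pc nb ⟨x, t₁, t₂, U⟩).t₁
      (VinvStep Pc nb ⟨x, t₁, t₂, U⟩).t₂ (VinvStep Pc nb ⟨x, t₁, t₂, U⟩).U ∧
    frameParity (VinvStep Pc nb ⟨x, t₁, t₂, U⟩).t₁ (VinvStep Pc nb ⟨x, t₁, t₂, U⟩).t₂
        (VinvStep Pc nb ⟨x, t₁, t₂, U⟩).U = lowerParity t₁ t₂ (lowerCap (Pc x) t₁ t₂ U) ∧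
    ((lowerParity t₁ t₂ (lowerCap (Pc x) t₁ t₂ U) = 1 ∧
      (VinvStep Pc nb ⟨x, t₁, t₂, U⟩).U =
        {zlab Pc nb (nb x (apexOf t₁ t₂ (lowerCap (Pc x) t₁ t₂ U))) x,
          zlab Pc nb (nb x (apexOf t₁ t₂ (lowerCap (Pc x) t₁ t₂ U))) x - (VinvStep Pc nb ⟨x, t₁, t₂, U⟩).t₁,
          zlab Pc nb (nb x (apexOf t₁ t₂ (lowerCap (Pc x) t₁ t₂ U))) x - (VinvStep Pc nb ⟨x, t₁, t₂, U⟩).t₂} ∧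
      nb (nb x (apexOf t₁ t₂ (lowerCap (Pc x) t₁ t₂ U)))
          (zlab Pc nb (nb x (apexOf t₁ t₂ (lowerCap (Pc x) t₁ t₂ U))) x -
            (VinvStep Pc nb ⟨x, t₁, t₂, U⟩).t₁) = nb x (-t₁) ∧
      nb (nb x (apexOf t₁ t₂ (lowerCap (Pc x) t₁ t₂ U)))
          (zlab Pc nb (nb x (apexOf t₁ t₂ (lowerCap (Pc x) t₁ t₂ U))) x -
            (VinvStep Pc nb ⟨x, t₁, t₂, U⟩).t₂) = nb x (-t₂) ∧
      lowerCap (Pc x) t₁ t₂ U = {apexOf t₁ t₂ (lowerCap (Pc x) t₁ t₂ U),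
        apexOf t₁ t₂ (lowerCap (Pc x) t₁ t₂ U) + t₁, apexOf t₁ t₂ (lowerCap (Pc x) t₁ t₂ U) + t₂}) ∨
     (lowerParity t₁ t₂ (lowerCap (Pc x) t₁ t₂ U) = -1 ∧
      (VinvStep Pc nb ⟨x, t₁, t₂, U⟩).U =
        {zlab Pc nb (nb x (apexOf t₁ t₂ (lowerCap (Pc x) t₁ t₂ U))) x,
          zlab Pc nb (nb x (apexOf t₁ t₂ (lowerCap (Pc x) t₁ t₂ U))) x + (VinvStep Pc nb ⟨x, t₁, t₂, U⟩).t₁,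
          zlab Pc nb (nb x (apexOf t₁ t₂ (lowerCap (Pc x) t₁ t₂ U))) x + (VinvStep Pc nb ⟨x, t₁, t₂, U⟩).t₂} ∧
      nb (nb x (apexOf t₁ t₂ (lowerCap (Pc x) t₁ t₂ U)))
          (zlab Pc nb (nb x (apexOf t₁ t₂ (lowerCap (Pc x) t₁ t₂ U))) x +
            (VinvStep Pc nb ⟨x, t₁, t₂, U⟩).t₁) = nb x t₁ ∧
      nb (nb x (apexOf t₁ t₂ (lowerCap (Pc x) t₁ t₂ U)))
          (zlab Pc nb (nb x (apexOf t₁ t₂ (lowerCap (Pc x) t₁ t₂ U))) x +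
            (VinvStep Pc nb ⟨x, t₁, t₂, U⟩).t₂) = nb x t₂ ∧
      lowerCap (Pc x) t₁ t₂ U = {apexOf t₁ t₂ (lowerCap (Pc x) t₁ t₂ U),
        apexOf t₁ t₂ (lowerCap (Pc x) t₁ t₂ U) - t₁, apexOf t₁ t₂ (lowerCap (Pc x) t₁ t₂ U) - t₂})) := by
  obtain ⟨h12, hhex, hUP, hoff, c, hcU, hform⟩ := id hU
  have hPx := pattern_cases hch hx
  have ht₁ : t₁ ∈ Pc x := hhex (mem_hexLabels_iff.2 (Or.inl rfl))
  have ht₂ : t₂ ∈ Pc x := hhex (mem_hexLabels_iff.2 (Or.inr (Or.inl rfl)))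
  have hnt₁ : -t₁ ∈ Pc x := hhex (mem_hexLabels_iff.2 (Or.inr (Or.inr (Or.inr (Or.inl rfl)))))
  have hnt₂ : -t₂ ∈ Pc x :=
    hhex (mem_hexLabels_iff.2 (Or.inr (Or.inr (Or.inr (Or.inr (Or.inl rfl))))))
  obtain ⟨d', hd'L, hd'P, hd'hex, hLcase⟩ := lowerCap_cases hPx hU
  have hLframe : IsFrame (Pc x) t₁ t₂ (lowerCap (Pc x) t₁ t₂ U) := isFrame_lowerCap hPx hU
  have hapexL : apexOf t₁ t₂ (lowerCap (Pc x) t₁ t₂ U) = d' := by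
    rcases hLcase with ⟨hLeq, -, -, -⟩ | ⟨hLeq, -, -, -⟩
    · exact apexOf_eq_of_form hPx hLframe hd'L (Or.inr hLeq)
    · exact apexOf_eq_of_form hPx hLframe hd'L (Or.inl hLeq)
  rw [hapexL]
  have hu := nb_mem hch hx hd'P
  have hPd := pattern_cases hch hu.1
  have hξ := zlab_spec hch hu.1 hx (bond_symm hu.2)
  set ξ := zlab Pc nb (nb x d') x with hξ_def
  have hyS : nb x t₁ ∈ S := (nb_mem hch hx ht₁).1
  have hy'S : nb x t₂ ∈ S := (nb_mem hch hx ht₂).1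
  have hymS : nb x (-t₁) ∈ S := (nb_mem hch hx hnt₁).1
  have hym'S : nb x (-t₂) ∈ S := (nb_mem hch hx hnt₂).1
  rcases hLcase with ⟨hLeq, hlp, hd1, hd2⟩ | ⟨hLeq, hlp, hd1, hd2⟩
  · /- letter below `+1`: `L = {d', d' + t₁, d' + t₂}`; the upper sites of `d` are `x, I⁻¹x, J⁻¹x` -/
    have hdx := dist_oddCap (Pc x) hPx t₁ ht₁ t₂ ht₂ d' hd'P h12 hhex hd'hex hd1 hd2
    have hbI : 0 < dist (nb x d') (nb x (-t₁)) ∧ dist (nb x d') (nb x (-t₁)) ≤ 28 / 25 :=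
      (bond_nb_iff hch hx hd'P hnt₁).2 (by rw [sqNormInt_sub_comm]; exact hdx.1)
    have hbJ : 0 < dist (nb x d') (nb x (-t₂)) ∧ dist (nb x d') (nb x (-t₂)) ≤ 28 / 25 :=
      (bond_nb_iff hch hx hd'P hnt₂).2 (by rw [sqNormInt_sub_comm]; exact hdx.2.1)
    have hη := zlab_spec hch hu.1 hymS hbI
    have hζ := zlab_spec hch hu.1 hym'S hbJ
    set η := zlab Pc nb (nb x d') (nb x (-t₁)) with hη_def
    set ζ := zlab Pc nb (nb x d') (nb x (-t₂)) with hζ_def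
    have Dηξ : sqNormInt (η - ξ) = 18 := by
      rw [hη_def, hξ_def, transfer_nb_centre hch hx hu.1 hu.2 hnt₁ hbI, sqNormInt_neg]
      exact sqNormInt_of_label hch hx ht₁
    have Dζξ : sqNormInt (ζ - ξ) = 18 := by
      rw [hζ_def, hξ_def, transfer_nb_centre hch hx hu.1 hu.2 hnt₂ hbJ, sqNormInt_neg]
      exact sqNormInt_of_label hch hx ht₂
    have Dηζ : sqNormInt (η - ζ) = 18 := by
      rw [hη_def, hζ_def, transfer_nb_nb hch hx hu.1 hu.2 hnt₁ hnt₂ hbI hbJ,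
        show -t₁ - -t₂ = t₂ - t₁ by abel, sqNormInt_sub_comm]
      exact h12
    -- `d` is attached to `I⁻¹x` and `J⁻¹x` through their LOWER caps
    have hregI : Pc (nb x (-t₁)) = fcc3Int ∨ Pc x = hcpInt ∨
        (-zlab Pc nb (nb x (-t₁)) x ∈ Pc (nb x (-t₁)) ∧
          -zlab Pc nb (nb x (-t₁)) (nb x (t₂ - t₁)) ∈ Pc (nb x (-t₁))) :=
      Or.inr (Or.inr ⟨hIi.2.1 (mem_hexLabels_iff.2 (Or.inr (Or.inr (Or.inr (Or.inl rfl))))),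
        hIi.2.1 (mem_hexLabels_iff.2 (Or.inr (Or.inr (Or.inr (Or.inr (Or.inl rfl))))))⟩)
    have hregJ : Pc (nb x (-t₂)) = fcc3Int ∨ Pc x = hcpInt ∨
        (-zlab Pc nb (nb x (-t₂)) x ∈ Pc (nb x (-t₂)) ∧
          -zlab Pc nb (nb x (-t₂)) (nb x (t₁ - t₂)) ∈ Pc (nb x (-t₂))) :=
      Or.inr (Or.inr ⟨hJi.2.1 (mem_hexLabels_iff.2 (Or.inr (Or.inr (Or.inr (Or.inr (Or.inl rfl)))))),
        hJi.2.1 (mem_hexLabels_iff.2 (Or.inr (Or.inr (Or.inr (Or.inl rfl)))))⟩)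
    obtain ⟨ℓ₁, -, -, hfiltI, hbu₁, -, hlamL₁⟩ := IinvStep_lower hch hx hU hregI
    obtain ⟨ℓ₂, -, -, hfiltJ, hbu₂, -, hlamL₂⟩ := JinvStep_lower hch hx hU hregJ
    have hfx := filter_oddCap (Pc x) hPx t₁ ht₁ t₂ ht₂ d' hd'P h12 hhex hd'hex hd1 hd2
    have hℓ₁ : ℓ₁ = d' := by
      have h1 := hfx.2.2.1
      rw [← hLeq, hfiltI] at h1
      exact Finset.singleton_injective h1
    have hℓ₂ : ℓ₂ = d' := by
      have h1 := hfx.2.2.2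
      rw [← hLeq, hfiltJ] at h1
      exact Finset.singleton_injective h1
    rw [hℓ₁] at hbu₁ hlamL₁
    rw [hℓ₂] at hbu₂ hlamL₂
    have hμ₁ := zlab_spec hch hymS hu.1 hbu₁
    have hμ₂ := zlab_spec hch hym'S hu.1 hbu₂
    have hos1 := onesided_at_lower_apex hch hx hymS hU hIi hd'L hlamL₁ hμ₁.2.symm
    have hos2 := onesided_at_lower_apex hch hx hym'S hU hJi hd'L hlamL₂ hμ₂.2.symm
    have hos : (-ξ ∈ Pc (nb x d') ∧ -η ∈ Pc (nb x d') ∧ -ζ ∈ Pc (nb x d')) ∨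
        (-ξ ∉ Pc (nb x d') ∧ -η ∉ Pc (nb x d') ∧ -ζ ∉ Pc (nb x d')) := by
      rcases hos1 with ⟨a1, a2⟩ | ⟨a1, a2⟩ <;> rcases hos2 with ⟨b1, b2⟩ | ⟨b1, b2⟩
      · exact Or.inl ⟨a1, a2, b2⟩
      · exact (b1 a1).elim
      · exact (a1 b1).elim
      · exact Or.inr ⟨a1, a2, b2⟩
    obtain ⟨hframeU, hcapeq, hparU⟩ := isFrame_capWith_even (Pc (nb x d')) hPd ξ hξ.1 η hη.1 ζ hζ.1
      (by rw [sqNormInt_sub_comm]; exact Dηξ) (by rw [sqNormInt_sub_comm]; exact Dζξ) Dηζ hos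
    have hV : VinvStep Pc nb ⟨x, t₁, t₂, U⟩ =
        ⟨nb x d', ξ - η, ξ - ζ, capWith (Pc (nb x d')) (ξ - η) (ξ - ζ) ξ⟩ := by
      simp only [VinvStep, hapexL, if_pos hlp]
      try rfl
    rw [hV]
    refine ⟨hd'L, hu.1, hu.2, hξ.1, hξ.2, hframeU, ?_, Or.inl ⟨hlp, ?_, ?_, ?_, hLeq⟩⟩
    · show frameParity (ξ - η) (ξ - ζ) (capWith (Pc (nb x d')) (ξ - η) (ξ - ζ) ξ) =
        lowerParity t₁ t₂ (lowerCap (Pc x) t₁ t₂ U)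
      rw [hlp]; exact hparU
    · show capWith (Pc (nb x d')) (ξ - η) (ξ - ζ) ξ = {ξ, ξ - (ξ - η), ξ - (ξ - ζ)}
      rw [hcapeq, sub_sub_cancel, sub_sub_cancel]
    · show nb (nb x d') (ξ - (ξ - η)) = nb x (-t₁)
      rw [sub_sub_cancel]; exact hη.2
    · show nb (nb x d') (ξ - (ξ - ζ)) = nb x (-t₂)
      rw [sub_sub_cancel]; exact hζ.2
  · /- letter below `−1`: `L = {d', d' − t₁, d' − t₂}`; the upper sites of `d` are `x, Ix, Jx` -/
    have hdx := dist_evenCap (Pc x) hPx t₁ ht₁ t₂ ht₂ d' hd'P h12 hhex hd'hex hd1 hd2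
    have hbI : 0 < dist (nb x d') (nb x t₁) ∧ dist (nb x d') (nb x t₁) ≤ 28 / 25 :=
      (bond_nb_iff hch hx hd'P ht₁).2 (by rw [sqNormInt_sub_comm]; exact hdx.2.1)
    have hbJ : 0 < dist (nb x d') (nb x t₂) ∧ dist (nb x d') (nb x t₂) ≤ 28 / 25 :=
      (bond_nb_iff hch hx hd'P ht₂).2 (by rw [sqNormInt_sub_comm]; exact hdx.1)
    have hη := zlab_spec hch hu.1 hyS hbI
    have hζ := zlab_spec hch hu.1 hy'S hbJ
    set η := zlab Pc nb (nb x d') (nb x t₁) with hη_def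
    set ζ := zlab Pc nb (nb x d') (nb x t₂) with hζ_def
    have Dηξ : sqNormInt (η - ξ) = 18 := by
      rw [hη_def, hξ_def, transfer_nb_centre hch hx hu.1 hu.2 ht₁ hbI]
      exact sqNormInt_of_label hch hx ht₁
    have Dζξ : sqNormInt (ζ - ξ) = 18 := by
      rw [hζ_def, hξ_def, transfer_nb_centre hch hx hu.1 hu.2 ht₂ hbJ]
      exact sqNormInt_of_label hch hx ht₂
    have Dηζ : sqNormInt (η - ζ) = 18 := by
      rw [hη_def, hζ_def, transfer_nb_nb hch hx hu.1 hu.2 ht₁ ht₂ hbI hbJ]; exact h12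
    have hregI : Pc (nb x t₁) = fcc3Int ∨ Pc x = hcpInt ∨
        (-zlab Pc nb (nb x t₁) x ∈ Pc (nb x t₁) ∧ -zlab Pc nb (nb x t₁) (nb x t₂) ∈ Pc (nb x t₁)) := by
      refine Or.inr (Or.inr ⟨hI.2.1 (mem_hexLabels_iff.2 (Or.inl rfl)), ?_⟩)
      have h6 := hI.2.1 (mem_hexLabels_iff.2 (Or.inr (Or.inr (Or.inr (Or.inr (Or.inr rfl))))))
      have e : (Istep Pc nb ⟨x, t₁, t₂, U⟩).t₁ - (Istep Pc nb ⟨x, t₁, t₂, U⟩).t₂ =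
          -zlab Pc nb (nb x t₁) (nb x t₂) := by
        show -zlab Pc nb (nb x t₁) x - (zlab Pc nb (nb x t₁) (nb x t₂) - zlab Pc nb (nb x t₁) x) = _
        abel
      rwa [e] at h6
    have hregJ : Pc (nb x t₂) = fcc3Int ∨ Pc x = hcpInt ∨
        (-zlab Pc nb (nb x t₂) x ∈ Pc (nb x t₂) ∧ -zlab Pc nb (nb x t₂) (nb x t₁) ∈ Pc (nb x t₂)) := by
      refine Or.inr (Or.inr ⟨hJ.2.1 (mem_hexLabels_iff.2 (Or.inr (Or.inl rfl))), ?_⟩)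
      have h3 := hJ.2.1 (mem_hexLabels_iff.2 (Or.inr (Or.inr (Or.inl rfl))))
      have e : (Jstep Pc nb ⟨x, t₁, t₂, U⟩).t₂ - (Jstep Pc nb ⟨x, t₁, t₂, U⟩).t₁ =
          -zlab Pc nb (nb x t₂) (nb x t₁) := by
        show -zlab Pc nb (nb x t₂) x - (zlab Pc nb (nb x t₂) (nb x t₁) - zlab Pc nb (nb x t₂) x) = _
        abel
      rwa [e] at h3
    obtain ⟨ℓ₁, -, -, hfiltI, hbu₁, -, hlamL₁⟩ := Istep_lower hch hx hU hregI
    obtain ⟨ℓ₂, -, -, hfiltJ, hbu₂, -, hlamL₂⟩ := Jstep_lower hch hx hU hregJ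
    have hfx := filter_evenCap (Pc x) hPx t₁ ht₁ t₂ ht₂ d' hd'P h12 hhex hd'hex hd1 hd2
    have hℓ₁ : ℓ₁ = d' := by
      have h1 := hfx.1
      rw [← hLeq, hfiltI] at h1
      exact Finset.singleton_injective h1
    have hℓ₂ : ℓ₂ = d' := by
      have h1 := hfx.2.1
      rw [← hLeq, hfiltJ] at h1
      exact Finset.singleton_injective h1
    rw [hℓ₁] at hbu₁ hlamL₁
    rw [hℓ₂] at hbu₂ hlamL₂
    have hμ₁ := zlab_spec hch hyS hu.1 hbu₁
    have hμ₂ := zlab_spec hch hy'S hu.1 hbu₂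
    have hos1 := onesided_at_lower_apex hch hx hyS hU hI hd'L hlamL₁ hμ₁.2.symm
    have hos2 := onesided_at_lower_apex hch hx hy'S hU hJ hd'L hlamL₂ hμ₂.2.symm
    have hos : (-ξ ∈ Pc (nb x d') ∧ -η ∈ Pc (nb x d') ∧ -ζ ∈ Pc (nb x d')) ∨
        (-ξ ∉ Pc (nb x d') ∧ -η ∉ Pc (nb x d') ∧ -ζ ∉ Pc (nb x d')) := by
      rcases hos1 with ⟨a1, a2⟩ | ⟨a1, a2⟩ <;> rcases hos2 with ⟨b1, b2⟩ | ⟨b1, b2⟩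
      · exact Or.inl ⟨a1, a2, b2⟩
      · exact (b1 a1).elim
      · exact (a1 b1).elim
      · exact Or.inr ⟨a1, a2, b2⟩
    obtain ⟨hframeU, hcapeq, hparU⟩ := isFrame_capWith_odd (Pc (nb x d')) hPd ξ hξ.1 η hη.1 ζ hζ.1
      (by rw [sqNormInt_sub_comm]; exact Dηξ) (by rw [sqNormInt_sub_comm]; exact Dζξ) Dηζ hos
    have hne : ¬ lowerParity t₁ t₂ (lowerCap (Pc x) t₁ t₂ U) = 1 := by rw [hlp]; norm_num
    have hV : VinvStep Pc nb ⟨x, t₁, t₂, U⟩ =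
        ⟨nb x d', η - ξ, ζ - ξ, capWith (Pc (nb x d')) (η - ξ) (ζ - ξ) ξ⟩ := by
      simp only [VinvStep, hapexL, if_neg hne]
      try rfl
    rw [hV]
    refine ⟨hd'L, hu.1, hu.2, hξ.1, hξ.2, hframeU, ?_, Or.inr ⟨hlp, ?_, ?_, ?_, hLeq⟩⟩
    · show frameParity (η - ξ) (ζ - ξ) (capWith (Pc (nb x d')) (η - ξ) (ζ - ξ) ξ) =
        lowerParity t₁ t₂ (lowerCap (Pc x) t₁ t₂ U)
      rw [hlp]; exact hparU
    · show capWith (Pc (nb x d')) (η - ξ) (ζ - ξ) ξ = {ξ, ξ + (η - ξ), ξ + (ζ - ξ)}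
      rw [hcapeq, show ξ + (η - ξ) = η by abel, show ξ + (ζ - ξ) = ζ by abel]
    · show nb (nb x d') (ξ + (η - ξ)) = nb x t₁
      rw [show ξ + (η - ξ) = η by abel]; exact hη.2
    · show nb (nb x d') (ξ + (ζ - ξ)) = nb x t₂
      rw [show ξ + (ζ - ξ) = ζ by abel]; exact hζ.2

end Summit.AtomisticToContinuum.Crystallization.Theorems.PalmUnimodularRigidityShellsToBarlowChart.Clean

end
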